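import Literature.AlgebraicGeometry.Frobenioids.Thm34Sub
import Literature.AlgebraicGeometry.Frobenioids.EquivalenceUnitsTransport
import HarnessLib

/-!
# Frobenioids I, Theorem 3.4 sub-DAG: hypothesis plumbing for `Thm34Sub` — base-isomorphisms from `StdHyp`

Mochizuki, *The geometry of Frobenioids I*, Kyushu J. Math. **62** (2008), Thm. 3.4 pp. 62–63
[cite: MochizukiFrdI2008, Thm. 3.4 pp.62-63].

PROOF-ONLY (abc-iut-L1-d8, S1 holder). The closers of the Thm. 3.4 (iv)/(v) slots of `Thm34Sub.lean`
(abc-iut-L1-d4's `L13` term, abc-iut-w4-d093's `L08` case split) all need ONE input from the hypothesis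
bundle `StdHyp` = (a) standard type + (b) `HypB` (+ Frobenioid, FSM-type bases): **`Ψ` and `Ψ⁻¹` preserve
base-isomorphisms** (`preservesBaseIso_of_stdHyp`). Print obtains it by the case split of p. 62: if both sides
admit a non-group-like object this is Thm. 3.4 (iii) (abc-iut-L1-t13's FSM-type theorem, for `Ψ` and for
`Ψ⁻¹ = Ψ.symm`); otherwise BOTH `C₁, C₂` are of group-like type (an equivalence reflects and preserves
group-like objects, Thm. 3.4 (ii)), and (b) applies. Also: `StdHyp`/`FSMHyp` are symmetric under `Ψ ↦ Ψ⁻¹`.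
-/

namespace Literature.AlgebraicGeometry.Frobenioids

namespace FrdI

namespace Thm34Sub

open CategoryTheory PreFrobenioidData

universe w v v' u u'

variable {D₁ : Type u} [Category.{v} D₁] {Φ₁ : D₁ᵒᵖ ⥤ CommMonCat.{w}} {C₁ : Type u'} [Category.{v'} C₁]
  {D₂ : Type u} [Category.{v} D₂] {Φ₂ : D₂ᵒᵖ ⥤ CommMonCat.{w}} {C₂ : Type u'} [Category.{v'} C₂]
  (F₁ : C₁ ⥤ ElemFrobenioid Φ₁) (F₂ : C₂ ⥤ ElemFrobenioid Φ₂) (Ψ : C₁ ≌ C₂)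

/-- `FSMHyp` is symmetric in the two Frobenioids. [cite: MochizukiFrdI2008, Thm. 3.4 (iii) p.62] -/
theorem fsmHyp_symm (h : FSMHyp F₁ F₂) : FSMHyp F₂ F₁ :=
  ⟨h.isFrobenioid₂, h.isFrobenioid₁, h.quasiIsotropic₂, h.quasiIsotropic₁, h.fsm₂, h.fsm₁, h.nonDilating₂,
    h.nonDilating₁, h.nonGroupLike₂, h.nonGroupLike₁⟩

/-- Hypothesis (b) is symmetric under `Ψ ↦ Ψ⁻¹` (`Ψ.symm.functor = Ψ.inverse`, `Ψ.symm.inverse = Ψ.functor`).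
[cite: MochizukiFrdI2008, Thm. 3.4 (iii) p.62] -/
theorem hypB_symm (h : HypB (ofFunctor Φ₁ F₁) (ofFunctor Φ₂ F₂) Ψ) :
    HypB (ofFunctor Φ₂ F₂) (ofFunctor Φ₁ F₁) Ψ.symm :=
  fun h₂ h₁ => ⟨(h h₁ h₂).2, (h h₁ h₂).1⟩

/-- `StdHyp` is symmetric under `Ψ ↦ Ψ⁻¹`. [cite: MochizukiFrdI2008, Thm. 3.4 (iii) p.62] -/
theorem stdHyp_symm (h : StdHyp F₁ F₂ Ψ) : StdHyp F₂ F₁ Ψ.symm :=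
  ⟨h.isFrobenioid₂, h.isFrobenioid₁, h.fsm₂, h.fsm₁, h.standard₂, h.standard₁, hypB_symm F₁ F₂ Ψ h.hypB⟩

/-- Standard type supplies the FSM-type hypothesis bundle as soon as both sides admit a non-group-like object
(standard type (a) ⊇ quasi-isotropic, (e) non-dilating). [cite: MochizukiFrdI2008, Def. 3.1 (i) p.56] -/
theorem fsmHyp_of_stdHyp (h : StdHyp F₁ F₂ Ψ) (hN₁ : ∃ A : C₁, ¬ (ofFunctor Φ₁ F₁).IsGroupLikeObj A)
    (hN₂ : ∃ A : C₂, ¬ (ofFunctor Φ₂ F₂).IsGroupLikeObj A) : FSMHyp F₁ F₂ :=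
  ⟨h.isFrobenioid₁, h.isFrobenioid₂, h.standard₁.quasiIsotropic, h.standard₂.quasiIsotropic, h.fsm₁, h.fsm₂,
    h.standard₁.nonDilating, h.standard₂.nonDilating, hN₁, hN₂⟩

/-- `Ψ` preserves group-like objects (Thm. 3.4 (ii) over FSM-type bases, abc-iut-L1-t13).
[cite: MochizukiFrdI2008, Thm. 3.4 (ii) p.62] -/
theorem isGroupLikeObj_map (h : StdHyp F₁ F₂ Ψ) {A : C₁} (hA : (ofFunctor Φ₁ F₁).IsGroupLikeObj A) :
    (ofFunctor Φ₂ F₂).IsGroupLikeObj (Ψ.functor.obj A) :=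
  (thm34ii_of_isOfFSMType h.isFrobenioid₁ h.isFrobenioid₂ h.standard₁.quasiIsotropic
    h.standard₂.quasiIsotropic h.fsm₁ h.fsm₂ Ψ).2.2 hA

/-- `Ψ` reflects group-like objects (apply (ii) to `Ψ⁻¹` and transport along `A ≅ Ψ⁻¹ Ψ A`).
[cite: MochizukiFrdI2008, Thm. 3.4 (ii) p.62] -/
theorem not_isGroupLikeObj_map (h : StdHyp F₁ F₂ Ψ) {A : C₁} (hA : ¬ (ofFunctor Φ₁ F₁).IsGroupLikeObj A) :
    ¬ (ofFunctor Φ₂ F₂).IsGroupLikeObj (Ψ.functor.obj A) := fun hB =>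
  hA (PreFrobenioid.IsGroupLikeObj.of_iso F₁ (Ψ.unitIso.app A).symm
    (isGroupLikeObj_map F₂ F₁ Ψ.symm (stdHyp_symm F₁ F₂ Ψ h) hB))

/-- **`Ψ` and `Ψ⁻¹` preserve base-isomorphisms under (a) + (b)** (the input `hBI` of the Thm. 3.4 (iv)/(v)
closers): case split of p. 62 — non-group-like objects on both sides ⇒ Thm. 3.4 (iii) (FSM-type variant, for
`Ψ` and for `Ψ.symm`); else both `C₁, C₂` are of group-like type and hypothesis (b) applies.
[cite: MochizukiFrdI2008, Thm. 3.4 (iii) p.62] -/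
theorem preservesBaseIso_of_stdHyp (h : StdHyp F₁ F₂ Ψ) :
    PreservesMor Ψ.functor (ofFunctor Φ₁ F₁).IsBaseIso (ofFunctor Φ₂ F₂).IsBaseIso ∧
      PreservesMor Ψ.inverse (ofFunctor Φ₂ F₂).IsBaseIso (ofFunctor Φ₁ F₁).IsBaseIso := by
  by_cases hN₁ : ∃ A : C₁, ¬ (ofFunctor Φ₁ F₁).IsGroupLikeObj A
  · obtain ⟨A, hA⟩ := hN₁
    have hN₂ : ∃ B : C₂, ¬ (ofFunctor Φ₂ F₂).IsGroupLikeObj B := ⟨_, not_isGroupLikeObj_map F₁ F₂ Ψ h hA⟩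
    have hf : FSMHyp F₁ F₂ := fsmHyp_of_stdHyp F₁ F₂ Ψ h ⟨A, hA⟩ hN₂
    have hf' : FSMHyp F₂ F₁ := fsmHyp_symm F₁ F₂ hf
    exact ⟨(thm34iii_FSM_holds F₁ F₂ Ψ hf).1.2.2.1, (thm34iii_FSM_holds F₂ F₁ Ψ.symm hf').1.2.2.1⟩
  · push Not at hN₁
    have hg₁ : (ofFunctor Φ₁ F₁).IsOfGroupLikeType := ⟨hN₁⟩
    have hg₂ : (ofFunctor Φ₂ F₂).IsOfGroupLikeType := ⟨fun B =>
      PreFrobenioid.IsGroupLikeObj.of_iso F₂ (Ψ.counitIso.app B)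
        (isGroupLikeObj_map F₁ F₂ Ψ h (hN₁ (Ψ.inverse.obj B)))⟩
    exact h.hypB hg₁ hg₂

/-- The same for `StdHyp` read through `HypB`'s two components separately: `Ψ` preserves base-isomorphisms.
[cite: MochizukiFrdI2008, Thm. 3.4 (iii) p.62] -/
theorem isBaseIso_map (h : StdHyp F₁ F₂ Ψ) {A B : C₁} (f : A ⟶ B) (hf : (ofFunctor Φ₁ F₁).IsBaseIso f) :
    (ofFunctor Φ₂ F₂).IsBaseIso (Ψ.functor.map f) :=
  (preservesBaseIso_of_stdHyp F₁ F₂ Ψ h).1 f hf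

/-- … and `Ψ⁻¹` preserves base-isomorphisms. [cite: MochizukiFrdI2008, Thm. 3.4 (iii) p.62] -/
theorem isBaseIso_inverse_map (h : StdHyp F₁ F₂ Ψ) {A B : C₂} (f : A ⟶ B) (hf : (ofFunctor Φ₂ F₂).IsBaseIso f) :
    (ofFunctor Φ₁ F₁).IsBaseIso (Ψ.inverse.map f) :=
  (preservesBaseIso_of_stdHyp F₁ F₂ Ψ h).2 f hf

end Thm34Sub

end FrdI

end Literature.AlgebraicGeometry.Frobenioids
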